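import Mathlib
import Literature.RepresentationTheory.FiniteGroups.GLnTensorRankSpectrum
import Summits.MatrixMultiplication.MatrixMultiplication.Theorems.LevelGradedCohnUmansLieRankDesignsStubLevelFixedVector
import Summits.MatrixMultiplication.MatrixMultiplication.Theorems.SubgroupIdentityDesigns.Negative.PackingBridge

/-!
# The crux's level filtration sits inside the Gurevich–Howe tensor-rank filtration;
# the sharp count and the LINEAR level law for witnesses of `SubgroupIdentityDesigns`
# (support file for stmt-MatrixMultiplication-14079; cell B2b-5 `b2b-lgcu-borel`, gen 12 —
# report `run/shared/lean/b2b/levelgraded-cu/ORACLE-g12.md` §G12-2)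

Notation: `G = GL_m(𝔽_p)`, `F_k|_G = levelSet p m k` (functions `g ↦ Σ_M c_M ψ(tr(M g))`, `c`
supported on `rank M ≤ k`), `N_k = #(Irr(G) ∩ F_k)`, `ω^{⊗k}` = the permutation representation of
`G` on `m × k` matrices (character `GLn.tensorPermChar`: `g ↦ #{M : g M = M}`), and
`\widehat{GL}_m(ω^{⊗≤k}) = GLn.tensorSpectrumLE (ZMod p) m k` = the irreducible characters occurring
in some `ω^{⊗l}`, `l ≤ k` (Gurevich–Howe, *Harmonic analysis on `GL_n` over finite fields*, §2.2).
Proved here (sorry-free):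

* `irrChars_inter_levelSet_subset_tensorSpectrumLE` — **`Irr(G) ∩ F_k ⊆ \widehat{GL}_m(ω^{⊗≤k})`**
  (`1 ≤ k ≤ m`): an irreducible character lying in the level `F_k` occurs in `ω^{⊗k}`.  Proof:
  `⟨χ, ω^{⊗k}⟩ = |G|⁻¹ Σ_M Σ_{g M = M} χ(g)`; each inner sum is `|Stab M| · dim V^{Stab M} ∈ ℕ`
  (`Representation.card_inv_mul_sum_char_eq_finrank`), and the one at the standard frame
  `M = E = (e_0 … e_{k-1})` is `≠ 0` by the landed frame-duality half `stub_levelFixedVector`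
  (a level-`k` irreducible character does not average to zero over the frame stabiliser);
* `ncard_irr_level_le_sum_card_conjClasses` — hence, **conditionally on the vendored Gurevich–Howe
  eta-correspondence count** `GurevichHowe2021_etaCorrespondence_card` (Literature fact, cite item
  wi-48508), the SHARP COUNT `N_k ≤ Σ_{j ≤ k} #Cl(GL_j(𝔽_p))` in the stable range `2k ≤ m`
  (replacing `N_k ≤ p^{4k²}` of `LevelCount`);
* `sharp_law` — every witness of the crux at `ε` with `1 ≤ k`, `2k ≤ m` has
  `2^{(2+ε)/3} < (Σ_{j ≤ k} #Cl(GL_j(𝔽_p)))^ε` (chain with `PackingBridge.crux_law`);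
* `linear_level_law` — adding the classical class-number bound `#Cl(GL_j(𝔽_q)) ≤ q^j` (`j ≤ k`;
  an explicit hypothesis here, to be vendored as a Literature fact) gives `Σ_{j≤k} #Cl ≤ 2p^k − 1`
  and the LINEAR LEVEL LAW **`(2 − 2ε)/3 · log 2 < k · ε · log p`**, i.e. `k · log₂ p > 2(1−ε)/(3ε)`:
  a witness at `ε = 1/100` needs level `k ≥ 67` over `𝔽_2` (the quadratic law
  `LevelCountLaw.witness_law`, `log 2/(6ε) < k² log p`, only gave `k ≥ 5`);
* `field_degree_law` — with the class-number bound at `j = m` alone (no Gurevich–Howe):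
  `(2+ε)/3 · log 2 < m · ε · log p` (chain with `PackingBridge.crux_conjClasses_law`).

VALUE = theorem (structural constraint on hypothetical witnesses; the first item is unconditional),
NOT summit progress; the crux item stays open.
-/

set_option linter.dupNamespace false

noncomputable section

open scoped BigOperators Matrix
open Module Literature.RepresentationTheory.FiniteGroups
open Literature.Barriers.MatrixMultiplication (SubgroupTPP)

namespace Summit.MatrixMultiplication.MatrixMultiplication.Theorems.SubgroupIdentityDesigns.Negative
namespace TensorRankBridge

open Summit.MatrixMultiplication.MatrixMultiplication.Theorems.LieRankDesigns.Negative
  (GLm Mat levelSet budget fourierFn RankSupp)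
open Summit.MatrixMultiplication.MatrixMultiplication.Theorems.LieRankDesigns (stub_levelFixedVector)
open Summit.MatrixMultiplication.MatrixMultiplication.Theorems.LieRankDesigns.LevelFixedVector
  (exists_frameStab finsum_mem_setOf_eq_sum)

variable {p : ℕ} [hp : Fact p.Prime] {m : ℕ}

/-! ## Stabiliser sums of a character are natural numbers -/

/-- The stabiliser `{g : g M = M}` of an `m × k` matrix under left multiplication is a subgroup
(stated as an existence theorem: no definitions in this helper file). [folklore] -/
theorem exists_stab {k : ℕ} (M : Matrix (Fin m) (Fin k) (ZMod p)) :
    ∃ H : Subgroup (GLm p m), ∀ g : GLm p m, g ∈ H ↔ (g : Mat p m) * M = M := by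
  refine ⟨{ carrier := {g | (g : Mat p m) * M = M}
            mul_mem' := ?_
            one_mem' := ?_
            inv_mem' := ?_ }, fun g => Iff.rfl⟩
  · intro a b ha hb
    simp only [Set.mem_setOf_eq] at ha hb ⊢
    rw [Units.val_mul, Matrix.mul_assoc, hb, ha]
  · simp
  · intro a ha
    simp only [Set.mem_setOf_eq] at ha ⊢
    calc ((a⁻¹ : GLm p m) : Mat p m) * M = ((a⁻¹ : GLm p m) : Mat p m) * ((a : Mat p m) * M) := by
          rw [ha]
      _ = M := by rw [← Matrix.mul_assoc, Units.inv_mul, Matrix.one_mul]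

/-- `Σ_{g : g M = M} χ_ρ(g) = |Stab M| · dim V^{Stab M}`, a natural number. [folklore] -/
theorem exists_nat_stabSum_eq {k : ℕ} {V : Type} [AddCommGroup V] [Module ℂ V]
    [FiniteDimensional ℂ V] (ρ : Representation ℂ (GLm p m) V)
    (M : Matrix (Fin m) (Fin k) (ZMod p)) :
    ∃ n : ℕ, (∑ g : GLm p m, if (g : Mat p m) * M = M then ρ.character g else 0) = (n : ℂ) := by
  classical
  obtain ⟨H, hH⟩ := exists_stab (p := p) M
  have hsum : (∑ g : GLm p m, if (g : Mat p m) * M = M then ρ.character g else 0) =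
      ∑ h : H, ρ.character h := by
    rw [← Finset.sum_filter]
    refine Finset.sum_subtype _ (fun (g : GLm p m) => ?_) _
    rw [Finset.mem_filter, hH]
    simp
  have hne : (Nat.card H : ℂ) ≠ 0 := Nat.cast_ne_zero.mpr (Nat.card_pos (α := H)).ne'
  haveI : Invertible (Nat.card H : ℂ) := invertibleOfNonzero hne
  have key := Representation.card_inv_mul_sum_char_eq_finrank (ρ.comp H.subtype)
  have hchar : ∀ g : H, Representation.character (ρ.comp H.subtype) g = ρ.character g := fun g => rfl
  simp only [hchar] at key
  refine ⟨Nat.card H * finrank ℂ (Representation.invariants (ρ.comp H.subtype)), ?_⟩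
  rw [hsum, (inv_mul_eq_iff_eq_mul₀ hne).mp key, Nat.cast_mul]

/-- `ω^{⊗k}(s⁻¹) = #{M : s M = M}` written as a sum of indicators. [folklore] -/
theorem tensorPermChar_inv_eq_sum {k : ℕ} (s : GLm p m) :
    GLn.tensorPermChar (ZMod p) m k s⁻¹ =
      ∑ M : Matrix (Fin m) (Fin k) (ZMod p), if (s : Mat p m) * M = M then (1 : ℂ) else 0 := by
  unfold GLn.tensorPermChar
  rw [Finset.natCast_card_filter]
  refine Finset.sum_congr rfl fun M _ => ?_
  have hiff : ((s⁻¹ : GLm p m) : Mat p m) * M = M ↔ (s : Mat p m) * M = M := by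
    constructor
    · intro h
      calc (s : Mat p m) * M = (s : Mat p m) * (((s⁻¹ : GLm p m) : Mat p m) * M) := by rw [h]
        _ = M := by rw [← Matrix.mul_assoc, Units.mul_inv, Matrix.one_mul]
    · intro h
      calc ((s⁻¹ : GLm p m) : Mat p m) * M = ((s⁻¹ : GLm p m) : Mat p m) * ((s : Mat p m) * M) := by
            rw [h]
        _ = M := by rw [← Matrix.mul_assoc, Units.inv_mul, Matrix.one_mul]
  by_cases h : (s : Mat p m) * M = M
  · rw [if_pos h, if_pos (hiff.mpr h)]
  · rw [if_neg h, if_neg (fun h' => h (hiff.mp h'))]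

/-- `|G| · ⟨χ, ω^{⊗k}⟩ = Σ_M Σ_{g M = M} χ(g)` (swap the sums). [folklore] -/
theorem card_mul_classInner_eq {k : ℕ} (χ : GLm p m → ℂ) :
    (Fintype.card (GLm p m) : ℂ) * classInner χ (GLn.tensorPermChar (ZMod p) m k) =
      ∑ M : Matrix (Fin m) (Fin k) (ZMod p),
        ∑ g : GLm p m, if (g : Mat p m) * M = M then χ g else 0 := by
  have hG : (Fintype.card (GLm p m) : ℂ) ≠ 0 := Nat.cast_ne_zero.mpr Fintype.card_ne_zero
  rw [classInner_apply, ← mul_assoc, mul_inv_cancel₀ hG, one_mul]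
  simp_rw [tensorPermChar_inv_eq_sum, Finset.mul_sum]
  rw [Finset.sum_comm]
  refine Finset.sum_congr rfl fun M _ => Finset.sum_congr rfl fun g _ => ?_
  by_cases h : (g : Mat p m) * M = M
  · rw [if_pos h, if_pos h, mul_one]
  · rw [if_neg h, if_neg h, mul_zero]

/-- `classInner` does not depend on the `Fintype` instance (the one hidden in
`GLn.tensorSpectrum` is the classical one). [folklore] -/
theorem classInner_inst_irrel {G : Type} [Group G] (i₁ i₂ : Fintype G) (φ ψ : G → ℂ) :
    @classInner G _ i₁ φ ψ = @classInner G _ i₂ φ ψ := by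
  rw [Subsingleton.elim i₁ i₂]

/-! ## The standard frame -/

/-- `g E = E` for the standard frame `E = (e_0 … e_{k-1})` iff the first `k` columns of `g` are
those of `1` (the frame-stabiliser set of `stub_levelFixedVector`). [folklore] -/
theorem mul_stdFrame_eq_iff {k : ℕ} (hkm : k ≤ m) (g : GLm p m) :
    (g : Mat p m) * Matrix.of (fun (j : Fin m) (i : Fin k) => (1 : Mat p m) j (Fin.castLE hkm i)) =
        Matrix.of (fun (j : Fin m) (i : Fin k) => (1 : Mat p m) j (Fin.castLE hkm i)) ↔
      ∀ i j : Fin m, (i : ℕ) < k → (g : Mat p m) j i = (1 : Mat p m) j i := by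
  have hentry : ∀ (j : Fin m) (i : Fin k),
      ((g : Mat p m) *
          Matrix.of (fun (j : Fin m) (i : Fin k) => (1 : Mat p m) j (Fin.castLE hkm i))) j i =
        (g : Mat p m) j (Fin.castLE hkm i) := by
    intro j i
    rw [Matrix.mul_apply]
    simp only [Matrix.of_apply]
    calc ∑ l, (g : Mat p m) j l * (1 : Mat p m) l (Fin.castLE hkm i)
        = ((g : Mat p m) * (1 : Mat p m)) j (Fin.castLE hkm i) := (Matrix.mul_apply).symm
      _ = (g : Mat p m) j (Fin.castLE hkm i) := by rw [Matrix.mul_one]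
  constructor
  · intro h i j hi
    have := congr_fun (congr_fun h j) ⟨i, hi⟩
    rw [hentry, Matrix.of_apply] at this
    have hc : Fin.castLE hkm ⟨i, hi⟩ = i := Fin.ext rfl
    rwa [hc] at this
  · intro h
    ext j i
    rw [hentry, Matrix.of_apply]
    exact h (Fin.castLE hkm i) j (by simp)

/-! ## The bridge: level `k` irreducible characters occur in `ω^{⊗k}` -/

/-- **`Irr(GL_m(𝔽_p)) ∩ F_k ⊆ \widehat{GL}_m(ω^{⊗≤k})`** (`1 ≤ k ≤ m`): an irreducible character
lying in the crux's level `F_k` occurs in the permutation representation on `m × k` matrices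
(Gurevich–Howe's `k`-spectrum). -/
theorem irrChars_inter_levelSet_subset_tensorSpectrumLE {k : ℕ} (hk : 1 ≤ k) (hkm : k ≤ m) :
    irrChars (GLm p m) ∩ levelSet p m k ⊆ GLn.tensorSpectrumLE (ZMod p) m k := by
  classical
  intro χ hχ
  simp only [GLn.tensorSpectrumLE, GLn.tensorSpectrum, Set.mem_setOf_eq]
  refine ⟨k, le_rfl, hχ.1, fun h0 => ?_⟩
  -- the frame-stabiliser sum of `χ` is non-zero (landed frame duality, hard half)
  have hfix := stub_levelFixedVector p m k hk hkm χ hχ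
  obtain ⟨V, _, _, _, ρ, -, hρ⟩ := id hχ.1
  -- stabiliser sums are natural numbers
  have hnat : ∀ M : Matrix (Fin m) (Fin k) (ZMod p), ∃ n : ℕ,
      (∑ g : GLm p m, if (g : Mat p m) * M = M then χ g else 0) = (n : ℂ) := by
    intro M
    rw [← hρ]
    exact exists_nat_stabSum_eq ρ M
  choose n hn using hnat
  -- the one at the standard frame is non-zero
  obtain ⟨E, hE⟩ : ∃ E : Matrix (Fin m) (Fin k) (ZMod p),
      E = Matrix.of (fun (j : Fin m) (i : Fin k) => (1 : Mat p m) j (Fin.castLE hkm i)) := ⟨_, rfl⟩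
  obtain ⟨H, hH⟩ := exists_frameStab p m k
  have hEsum : (∑ g : GLm p m, if (g : Mat p m) * E = E then χ g else 0) ≠ 0 := by
    rw [finsum_mem_setOf_eq_sum H hH] at hfix
    have : (∑ g : GLm p m, if (g : Mat p m) * E = E then χ g else 0) = ∑ h : H, χ h := by
      rw [← Finset.sum_filter]
      refine Finset.sum_subtype _ (fun (g : GLm p m) => ?_) _
      rw [Finset.mem_filter, hH, hE, mul_stdFrame_eq_iff hkm g]
      simp
    rwa [this]
  have hnE : n E ≠ 0 := by
    intro h0
    apply hEsum
    rw [hn E, h0, Nat.cast_zero]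
  -- hence the total is a non-zero natural number
  have htot : (Fintype.card (GLm p m) : ℂ) * classInner χ (GLn.tensorPermChar (ZMod p) m k) =
      ((∑ M : Matrix (Fin m) (Fin k) (ZMod p), n M : ℕ) : ℂ) := by
    rw [card_mul_classInner_eq, Nat.cast_sum]
    exact Finset.sum_congr rfl fun M _ => hn M
  have hpos : 0 < ∑ M : Matrix (Fin m) (Fin k) (ZMod p), n M :=
    lt_of_lt_of_le (Nat.pos_of_ne_zero hnE)
      (Finset.single_le_sum (fun M _ => Nat.zero_le (n M)) (Finset.mem_univ E))
  -- (the `Fintype (GL_m(𝔽_p))` instance hidden in `h0`'s `classInner` is the classical one of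
  -- `GLn.tensorSpectrum`; `classInner_inst_irrel` moves it to the local instance)
  have h0' : classInner χ (GLn.tensorPermChar (ZMod p) m k) = 0 :=
    (classInner_inst_irrel _ _ χ _).trans h0
  rw [h0', mul_zero] at htot
  exact (Nat.cast_ne_zero.mpr hpos.ne') htot.symm

/-! ## The sharp count (conditional on the vendored Gurevich–Howe count) -/

/-- **SHARP COUNT** (`1 ≤ k`, `2k ≤ m`): conditionally on the Gurevich–Howe eta-correspondence count,
`#(Irr(GL_m(𝔽_p)) ∩ F_k) ≤ Σ_{j ≤ k} #Cl(GL_j(𝔽_p))`. -/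
theorem ncard_irr_level_le_sum_card_conjClasses (hGH : GurevichHowe2021_etaCorrespondence_card)
    {k : ℕ} (hk : 1 ≤ k) (h2k : 2 * k ≤ m) :
    (irrChars (GLm p m) ∩ levelSet p m k).ncard ≤
      ∑ j ∈ Finset.range (k + 1),
        Nat.card (ConjClasses (Matrix.GeneralLinearGroup (Fin j) (ZMod p))) := by
  rw [← hGH.cumulative_eq_sum_card_conjClasses (ZMod p) h2k]
  exact Set.ncard_le_ncard (irrChars_inter_levelSet_subset_tensorSpectrumLE hk (by omega))
    (GLn.tensorSpectrumLE_finite k)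

/-- **SHARP LAW.**  Conditionally on the Gurevich–Howe count: every witness of the crux at `ε`
with `1 ≤ k`, `2k ≤ m` has `2^{(2+ε)/3} < (Σ_{j ≤ k} #Cl(GL_j(𝔽_p)))^ε`. -/
theorem sharp_law (hGH : GurevichHowe2021_etaCorrespondence_card) {k : ℕ} (hk : 1 ≤ k)
    (h2k : 2 * k ≤ m) {ε : ℝ} (hε : 0 < ε)
    {H₁ H₂ H₃ : Subgroup (GLm p m)} (htpp : SubgroupTPP H₁ H₂ H₃)
    (hdes : ∃ c : Mat p m → ℂ, (∀ M, k < M.rank → c M = 0) ∧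
      (∑ M, c M * ZMod.stdAddChar (Matrix.trace (M * ((1 : GLm p m) : Mat p m)))) = 1 ∧
      ∀ a ∈ H₁, ∀ b ∈ H₂, ∀ g ∈ H₃, a * b * g ≠ 1 →
        (∑ M, c M * ZMod.stdAddChar
          (Matrix.trace (M * ((a * b * g : GLm p m) : Mat p m)))) = 0)
    (hlt : budget p m k (2 + ε) <
      ((Nat.card H₁ * Nat.card H₂ * Nat.card H₃ : ℕ) : ℝ) ^ ((2 + ε) / 3)) :
    (2 : ℝ) ^ ((2 + ε) / 3) <
      ((∑ j ∈ Finset.range (k + 1),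
        Nat.card (ConjClasses (Matrix.GeneralLinearGroup (Fin j) (ZMod p))) : ℕ) : ℝ) ^ ε := by
  have h := PackingBridge.crux_law hε htpp hdes hlt
  refine lt_of_lt_of_le h (Real.rpow_le_rpow (Nat.cast_nonneg _) ?_ hε.le)
  exact_mod_cast ncard_irr_level_le_sum_card_conjClasses hGH hk h2k

/-- Geometric sum: `Σ_{j ≤ k} p^j ≤ 2 p^k − 1` for `p ≥ 2`. [folklore] -/
theorem sum_pow_le {q : ℕ} (hq : 2 ≤ q) (k : ℕ) :
    ∑ j ∈ Finset.range (k + 1), q ^ j ≤ 2 * q ^ k - 1 := by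
  induction k with
  | zero => simp
  | succ k ih =>
    rw [Finset.sum_range_succ]
    have h1 : 1 ≤ q ^ k := Nat.one_le_pow _ _ (by omega)
    have h2 : 2 * q ^ k ≤ q ^ (k + 1) := by
      rw [pow_succ, mul_comm]
      exact Nat.mul_le_mul_left _ hq
    omega

/-- **LINEAR LEVEL LAW.**  Conditionally on the Gurevich–Howe count and on the class-number bound
`#Cl(GL_j(𝔽_p)) ≤ p^j` (`j ≤ k`): every witness of the crux at `ε` with `1 ≤ k`, `2k ≤ m` has
`(2 − 2ε)/3 · log 2 < k · ε · log p`, i.e. `k · log₂ p > 2(1 − ε)/(3ε)` (at `ε = 1/100`: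
`k ≥ 67` over `𝔽_2`). -/
theorem linear_level_law (hGH : GurevichHowe2021_etaCorrespondence_card) {k : ℕ} (hk : 1 ≤ k)
    (h2k : 2 * k ≤ m)
    (hcl : ∀ j ≤ k, Nat.card (ConjClasses (Matrix.GeneralLinearGroup (Fin j) (ZMod p))) ≤ p ^ j)
    {ε : ℝ} (hε : 0 < ε)
    {H₁ H₂ H₃ : Subgroup (GLm p m)} (htpp : SubgroupTPP H₁ H₂ H₃)
    (hdes : ∃ c : Mat p m → ℂ, (∀ M, k < M.rank → c M = 0) ∧
      (∑ M, c M * ZMod.stdAddChar (Matrix.trace (M * ((1 : GLm p m) : Mat p m)))) = 1 ∧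
      ∀ a ∈ H₁, ∀ b ∈ H₂, ∀ g ∈ H₃, a * b * g ≠ 1 →
        (∑ M, c M * ZMod.stdAddChar
          (Matrix.trace (M * ((a * b * g : GLm p m) : Mat p m)))) = 0)
    (hlt : budget p m k (2 + ε) <
      ((Nat.card H₁ * Nat.card H₂ * Nat.card H₃ : ℕ) : ℝ) ^ ((2 + ε) / 3)) :
    (2 - 2 * ε) / 3 * Real.log 2 < k * ε * Real.log p := by
  have hp2 : 2 ≤ p := hp.out.two_le
  have hpR : (0 : ℝ) < p := by exact_mod_cast hp.out.pos
  -- the count is `≤ 2 p^k − 1 < 2 p^k`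
  have hN : ∑ j ∈ Finset.range (k + 1),
      Nat.card (ConjClasses (Matrix.GeneralLinearGroup (Fin j) (ZMod p))) < 2 * p ^ k := by
    have h1 : ∑ j ∈ Finset.range (k + 1),
        Nat.card (ConjClasses (Matrix.GeneralLinearGroup (Fin j) (ZMod p))) ≤
          ∑ j ∈ Finset.range (k + 1), p ^ j :=
      Finset.sum_le_sum fun j hj => hcl j (by rw [Finset.mem_range] at hj; omega)
    have h2 := sum_pow_le hp2 k
    have h3 : 1 ≤ p ^ k := Nat.one_le_pow _ _ hp.out.pos
    omega
  have h := sharp_law hGH hk h2k hε htpp hdes hlt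
  have hlt2 : (2 : ℝ) ^ ((2 + ε) / 3) < ((2 * p ^ k : ℕ) : ℝ) ^ ε :=
    lt_of_lt_of_le h (Real.rpow_le_rpow (Nat.cast_nonneg _) (by exact_mod_cast hN.le) hε.le)
  have hsplit : ((2 * p ^ k : ℕ) : ℝ) ^ ε = (2 : ℝ) ^ ε * (p : ℝ) ^ ((k : ℝ) * ε) := by
    push_cast
    rw [Real.mul_rpow (by norm_num) (by positivity), ← Real.rpow_natCast, ← Real.rpow_mul hpR.le]
  rw [hsplit] at hlt2
  have hlog := Real.log_lt_log (by positivity) hlt2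
  rw [Real.log_rpow (by norm_num), Real.log_mul (by positivity) (by positivity),
    Real.log_rpow (by norm_num), Real.log_rpow hpR] at hlog
  nlinarith [hlog, Real.log_pos (show (1 : ℝ) < 2 by norm_num)]

/-- **FIELD–DEGREE LAW** (no Gurevich–Howe needed).  With the class-number bound
`#Cl(GL_m(𝔽_p)) ≤ p^m` for the host: every witness of the crux at `ε` has
`(2+ε)/3 · log 2 < m · ε · log p`, i.e. `m · log₂ p > (2+ε)/(3ε)`. -/
theorem field_degree_law {k : ℕ} (hclm : Nat.card (ConjClasses (GLm p m)) ≤ p ^ m)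
    {ε : ℝ} (hε : 0 < ε)
    {H₁ H₂ H₃ : Subgroup (GLm p m)} (htpp : SubgroupTPP H₁ H₂ H₃)
    (hdes : ∃ c : Mat p m → ℂ, (∀ M, k < M.rank → c M = 0) ∧
      (∑ M, c M * ZMod.stdAddChar (Matrix.trace (M * ((1 : GLm p m) : Mat p m)))) = 1 ∧
      ∀ a ∈ H₁, ∀ b ∈ H₂, ∀ g ∈ H₃, a * b * g ≠ 1 →
        (∑ M, c M * ZMod.stdAddChar
          (Matrix.trace (M * ((a * b * g : GLm p m) : Mat p m)))) = 0)
    (hlt : budget p m k (2 + ε) <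
      ((Nat.card H₁ * Nat.card H₂ * Nat.card H₃ : ℕ) : ℝ) ^ ((2 + ε) / 3)) :
    (2 + ε) / 3 * Real.log 2 < m * ε * Real.log p := by
  have hpR : (0 : ℝ) < p := by exact_mod_cast hp.out.pos
  have h := PackingBridge.crux_conjClasses_law hε htpp hdes hlt
  have hlt2 : (2 : ℝ) ^ ((2 + ε) / 3) < ((p ^ m : ℕ) : ℝ) ^ ε :=
    lt_of_lt_of_le h (Real.rpow_le_rpow (Nat.cast_nonneg _) (by exact_mod_cast hclm) hε.le)
  have hsplit : ((p ^ m : ℕ) : ℝ) ^ ε = (p : ℝ) ^ ((m : ℝ) * ε) := by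
    push_cast
    rw [← Real.rpow_natCast, ← Real.rpow_mul hpR.le]
  rw [hsplit] at hlt2
  have hlog := Real.log_lt_log (by positivity) hlt2
  rw [Real.log_rpow (by norm_num), Real.log_rpow hpR] at hlog
  linarith

end TensorRankBridge
end Summit.MatrixMultiplication.MatrixMultiplication.Theorems.SubgroupIdentityDesigns.Negative
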